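import Literature.NumberTheory.EllipticCurves.SelmerCorankControlRatOrdinaryLayerTwoProofs
import Literature.NumberTheory.EllipticCurves.OrdinaryLocalKummerCountLayerProofs
import HarnessLib

/-!
# Greenberg's Lemma 3.4 at EVERY layer of the cyclotomic `ℤ₂`-extension for `E/ℚ` good ordinary
# at `2` — the layer Kummer count (C1ₙ) discharged

`Proofs` file (theorems only: **no definition, no named fact, nothing asserted**) in topic
`NumberTheory/EllipticCurves`, closing the route of the `LayerUniformizer`/`LayerTwo` files (R.
Greenberg, *Iwasawa theory for elliptic curves*, LNM 1716 (1999), §3 Lemma 3.4, p. 89: for `v ∣ p`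
of good ordinary reduction and the cyclotomic `ℤ_p`-extension, `ker(H¹((ℚ_n)_v, E)[p^∞] → H¹(ℚ_{v,∞}, E))`
is finite; §2 Prop. 2.2, p. 73). Those files proved the finiteness of
`𝒦_{v,n}[p^∞] = W.localTowerKerPrimary κ ℚ_v n` MODULO the layer Kummer count (C1ₙ) ("the
`E₁ ∩ E[p^k]`-valued cocycles of `H_{v,n}` fall into `≤ c₀ p^{dk}` classes") and a uniformiser-like
`π` (`|π|^d = |p|`, `pⁿ ∣ d`, fixed by `H_{v,n}`). **This file discharges (C1ₙ)** from the layer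
cocycle count `WeierstrassCurve.exists_finset_cocycle_reps_of_ordinaryLine_layer`
(`OrdinaryLocalKummerCountLayerProofs`: Hilbert 90 on the open subgroup `H_{v,n}` + the twisted
Kummer count over the ramified layer `K̄_v^{N' ∩ H_{v,n}}` with uniformiser `π`):

* `WeierstrassCurve.exists_kummerCount_layer_of_ordinary` — **(C1ₙ) holds** for `W/ℚ` globally
  minimal, `p ∤ Δ_W`, `p ∤ a_p`, `κ` cyclotomic, every `n`, given `π`: `c₀ = #SF² · p^d` with `SF`
  the finite set of `τ`-fixed reductions ("`#Ẽ(𝔽_p)`").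
* `WeierstrassCurve.finite_localTowerKerPrimary_of_ordinary_of_uniformizer` — Lemma 3.4 at the layer
  `n` for every `p`, given only the `H_{v,n}`-fixed `π` with `|π|^d = |p|`, `pⁿ ∣ d`.
* `WeierstrassCurve.finite_localTowerKerPrimary_of_ordinary_two` — **`p = 2`, EVERY `n`,
  UNCONDITIONAL**: `π_n = 2 - (ζ_{2^{n+2}} + ζ_{2^{n+2}}⁻¹)` (`ZpExtension.IsCyclotomic.add_inv_mem_layer`,
  `spectralValuation_two_sub_add_inv_pow_eq`).

HONEST FRAMING (cell `bsd-f1-sign2`, WIDTH-5 attach seat `bsd-line-att-p5` g42 on crux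
stmt-BirchSwinnertonDyer-22298, lineage successor of g41): COROLLARY-OF-PRINT (Greenberg's Lemma
3.4 is a printed theorem; this is an elementary proof of its `p = 2` cyclotomic case at all layers);
the named fact `Greenberg1999.lemma34_natCard_localTowerKerPrimary_eq_rat` (an exact cardinality) is
NOT discharged — only finiteness; closes no item; BSD is not proved by any of this.

## References

* [GreenbergLNM1716] R. Greenberg, LNM 1716 (1999), §3 Lemma 3.4 (p. 89), §2 Prop. 2.2 (p. 73).
* [Washington1997] L. C. Washington, *Introduction to Cyclotomic Fields*, §13.1.

## Design

No definitions, no named facts; `noncomputable section`; one universe `u`; the reduction map `red₀`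
of `OrdinaryLocalReductionMapProofs` is rebuilt on the given spectral valuation exactly as in
`SelmerCorankControlRatOrdinaryLayerProofs`. Axioms: `propext`, `Classical.choice`, `Quot.sound`.
-/

noncomputable section

open scoped Classical NNReal AddSubgroup
open NumberField IsDedekindDomain Polynomial

universe u

namespace WeierstrassCurve

open Literature.NumberTheory.EllipticCurves Literature.NumberTheory.GaloisRepresentations Field
  IsDedekindDomain.HeightOneSpectrum Literature.NumberTheory.EllipticCurves.FormalGroupChart
  Literature.NumberTheory.EllipticCurves.ResKernel

/-! ## §1 (C1ₙ) for `E/ℚ` good ordinary at `p`, given a uniformiser-like `π` -/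

section Layer

variable (W : WeierstrassCurve ℚ) [W.IsGloballyMinimal] [W.IsElliptic] {p : ℕ} [hp : Fact p.Prime]
  {v : HeightOneSpectrum (𝓞 ℚ)}
  {w : Valuation (AlgebraicClosure (v.adicCompletion ℚ)) ℝ≥0}
  (hw : ∀ x, (w x : ℝ) = spectralNorm (v.adicCompletion ℚ) (AlgebraicClosure (v.adicCompletion ℚ)) x)

include hw in
set_option maxHeartbeats 3200000 in
/-- **The layer Kummer count (C1ₙ) for `E/ℚ` good ordinary at `p`.** Let `W/ℚ` be globally minimal
with `p ∤ Δ_W`, `p ∤ a_p`, `κ` the cyclotomic `ℤ_p`-extension, `v ∋ p`, `w` the spectral valuation of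
`K̄_v`, `E₁ = FormalGroupChart.kernel w (W ⊗ K̄_v)`, `H_{v,n} = (Γ_{ℚ_v} → Γ_ℚ)⁻¹(Gal(ℚ̄/ℚ_n))`, and
`π ∈ K̄_v` fixed by `H_{v,n}` with `|π|^d = |p|`, `pⁿ ∣ d`. Then there is `c₀` such that for every `k`
the continuous cocycles of `H_{v,n}` with values in `E₁ ∩ E[p^k]` fall into at most `c₀ · p^{dk}`
classes modulo coboundaries of `p^k`-torsion points — hypothesis (C1ₙ) of
`finite_localTowerKerPrimary_of_ordinary_of_count_of_uniformizer`. Proof: the layer cocycle count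
`exists_finset_cocycle_reps_of_ordinaryLine_layer` on the reduction map `red₀ : E(K̄_v) → Ẽ(k̄_v)` of
the integral model (`OrdinaryLocalReductionMapProofs`: ordinary filtration
`localRed_ordinary_filtration`, the Frobenius `τ ∈ H_{v,∞} ≤ H_{v,n}` fixing `μ_{p^∞}`
(`exists_isArithFrobAt_forall_smul_eq`, `resGal_mem_kerSubgroup_of_forall_smul_rootOfUnity_eq`),
`exists_finset_localRed_smul_frobenius`, the Teichmüller layers `exists_layer_localRed_smul_eq`),
`q = p`, `c₀ = #SF² · p^d`. Greenberg, LNM 1716, §2 Prop. 2.2 (p. 73: "`H¹(M_η, C)` has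
`ℤ_p`-corank `[M_η : ℚ_p]`") for `M_η = (ℚ_n)_p`. [cite: GreenbergLNM1716, §2 Prop. 2.2 (p. 73)] -/
theorem exists_kummerCount_layer_of_ordinary (hpv : (p : 𝓞 ℚ) ∈ v.asIdeal)
    (hΔ : ¬ (p : ℤ) ∣ minimalDiscriminantInt W) (hord : ¬ (p : ℤ) ∣ W.frobeniusTrace p)
    (κ : ZpExtension ℚ p) (hκ : κ.IsCyclotomic) (n : ℕ)
    [hV : (W.baseChange (AlgebraicClosure (v.adicCompletion ℚ))).IsIntegral w.integer]
    {d : ℕ} (hdn : p ^ n ∣ d) {π : AlgebraicClosure (v.adicCompletion ℚ)}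
    (hπH : ∀ σ ∈ localSubgroup (κ.layerSubgroup n) (v.adicCompletion ℚ), σ • π = π)
    (hπ : w π ^ d = w (p : AlgebraicClosure (v.adicCompletion ℚ))) :
    ∃ c₀ : ℕ, ∀ k : ℕ, ∃ S : Finset (contOneCocycles (discreteTopRep
      (localSubgroup (κ.layerSubgroup n) (v.adicCompletion ℚ)) (localPoints W (v.adicCompletion ℚ)))),
      S.card ≤ c₀ * p ^ (d * k) ∧ ∀ ψ : contOneCocycles (discreteTopRep
        (localSubgroup (κ.layerSubgroup n) (v.adicCompletion ℚ)) (localPoints W (v.adicCompletion ℚ))),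
        (∀ g, p ^ k • ψ.1 g = 0) →
        (∀ g, ((ψ.1 g : localPoints W (v.adicCompletion ℚ)) :
          (W.baseChange (AlgebraicClosure (v.adicCompletion ℚ))).toAffine.Point) ∈
            kernel w (W.baseChange (AlgebraicClosure (v.adicCompletion ℚ)))) →
          ∃ ψ₀ ∈ S, ∃ t : localPoints W (v.adicCompletion ℚ), p ^ k • t = 0 ∧
            ∀ g, ψ.1 g - ψ₀.1 g = g • t - t := by
  -- notation
  let Hn : Subgroup (absoluteGaloisGroup (v.adicCompletion ℚ)) :=
    localSubgroup (κ.layerSubgroup n) (v.adicCompletion ℚ)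
  let Hi : Subgroup (absoluteGaloisGroup (v.adicCompletion ℚ)) :=
    localSubgroup κ.kerSubgroup (v.adicCompletion ℚ)
  have hle : Hi ≤ Hn := localSubgroup_ker_le_layer κ (v.adicCompletion ℚ) n
  -- the model and the reduction map on the given spectral valuation
  have hvO : w.Integers w.valuationSubring := Valuation.valuationSubring.integers w
  have hΔu := W.isUnit_Δ_localIntModel hpv hw hΔ
  let red₀ : localPoints W (v.adicCompletion ℚ) →+
      (((integralModelInt W).map (algebraMap ℤ ↥w.valuationSubring)).map
        (IsLocalRing.residue ↥w.valuationSubring)).toAffine.Point :=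
    (goodReductionHom _ hvO hΔu).comp
      (Affine.Point.congrEquiv (localIntModel_baseChange W w.valuationSubring).symm).toAddMonoidHom
  have hred₀ : ∀ P : localPoints W (v.adicCompletion ℚ), red₀ P =
      ((integralModelInt W).map (algebraMap ℤ ↥w.valuationSubring)).reducePoint
        (Affine.Point.congrEquiv (localIntModel_baseChange W w.valuationSubring).symm P) :=
    fun P ↦ rfl
  have hker : ∀ P : localPoints W (v.adicCompletion ℚ), red₀ P = 0 ↔
      (P : (W.baseChange (AlgebraicClosure (v.adicCompletion ℚ))).toAffine.Point) ∈
        kernel w (W.baseChange (AlgebraicClosure (v.adicCompletion ℚ))) :=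
    fun P ↦ W.localRed_eq_zero_iff_mem_kernel hΔu red₀ hred₀ P
  -- residue characteristic `p`
  have hpO : w ((p : ℕ) : AlgebraicClosure (v.adicCompletion ℚ)) < 1 := by
    have h := spectralValuation_algebraMap_ringOfIntegers_lt_one (v := v) hw hpv
    rwa [map_natCast] at h
  haveI hchar : CharP (IsLocalRing.ResidueField ↥w.valuationSubring) p := by
    refine (CharP.charP_iff_prime_eq_zero hp.out).mpr ?_
    rw [← map_natCast (IsLocalRing.residue ↥w.valuationSubring), IsLocalRing.residue_eq_zero_iff,
      IsLocalRing.mem_maximalIdeal, mem_nonunits_iff, hvO.isUnit_iff_valuation_eq_one]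
    exact fun h ↦ absurd h (ne_of_lt (by simpa using hpO))
  -- the Frobenius fixing `μ_{p^∞}`, inside `H_{v,∞} ≤ H_{v,n}`
  obtain ⟨𝔐, h𝔐⟩ := v.localPrimesAbove_nonempty
  have hϖ : Irreducible ((p : ℕ) : v.adicCompletionIntegers ℚ) :=
    irreducible_natCast_adicCompletionIntegers_rat hpv
  obtain ⟨τ, hτ, hτfix⟩ := exists_isArithFrobAt_forall_smul_eq hw h𝔐 hpv hϖ
  have hτHn : τ ∈ Hn := hle
    ((mem_localSubgroup_iff _ _ τ).mpr (resGal_mem_kerSubgroup_of_forall_smul_rootOfUnity_eq hκ hτfix))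
  -- the inputs of `OrdinaryLocalReductionMapProofs`
  obtain ⟨hgenr, hsurj, -⟩ := W.localRed_ordinary_filtration hΔu red₀ hred₀
    (W.exists_zsmul_eq_zero_localRed_ne_zero hw hΔu red₀ hred₀ hpv hΔ hord)
  obtain ⟨SF, hSF⟩ := W.exists_finset_localRed_smul_frobenius hw hΔu red₀ hred₀ h𝔐 hτ
  have hstab : ∀ (σ : absoluteGaloisGroup (v.adicCompletion ℚ)) (Q : localPoints W (v.adicCompletion ℚ)),
      red₀ Q = 0 → red₀ (σ • Q) = 0 :=
    fun σ Q hQ ↦ (W.localRed_smul_eq_zero_iff hw hΔu red₀ hred₀ σ Q).mpr hQ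
  -- `q = p`
  have hq : Nat.card (IsLocalRing.ResidueField (v.adicCompletionIntegers ℚ)) = p := by
    rw [natCard_residueField_adicCompletionIntegers v,
      Rat.HeightOneSpectrum.primesEquiv_eq_of_natCast_mem v hp.out hpv]
  -- (C1ₙ) from the layer cocycle count
  refine ⟨SF.card * SF.card * p ^ d, fun k ↦ ?_⟩
  obtain ⟨S, hS, hrep⟩ := W.exists_finset_cocycle_reps_of_ordinaryLine_layer hw h𝔐 hpv hϖ red₀ hstab
    hτ hτfix hgenr hsurj SF hSF (W.exists_layer_localRed_smul_eq hw red₀ hred₀ h𝔐) κ n hτHn hdn hπH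
    hπ k
  rw [hq] at hS
  exact ⟨S, hS, fun ψ hψ hψr ↦ hrep ψ hψ fun g ↦ (hker _).mpr (hψr g)⟩

include hw in
/-- **Greenberg's Lemma 3.4 at the layer `n` for `E/ℚ` good ordinary at `p`, given a
uniformiser-like element of the layer.** Let `W/ℚ` be globally minimal with `p ∤ Δ_W`, `p ∤ a_p`,
`κ` the cyclotomic `ℤ_p`-extension, `v ∋ p`, `w` the spectral valuation of `K̄_v` (with an
integrality witness of `W ⊗ K̄_v`), and `π ∈ K̄_v` fixed by `H_{v,n}` with `|π|^d = |p|`, `pⁿ ∣ d`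
(a uniformiser of `(ℚ_n)_p` when `d = pⁿ`). Then `𝒦_{v,n}[p^∞] = W.localTowerKerPrimary κ ℚ_v n` is
finite: `finite_localTowerKerPrimary_of_ordinary_of_count_of_uniformizer` with (C1ₙ) from
`exists_kummerCount_layer_of_ordinary`. Greenberg, LNM 1716, §3 Lemma 3.4 (p. 89).
[cite: GreenbergLNM1716, §3 Lemma 3.4 (p. 89)] -/
theorem finite_localTowerKerPrimary_of_ordinary_of_uniformizer (hpv : (p : 𝓞 ℚ) ∈ v.asIdeal)
    (hΔ : ¬ (p : ℤ) ∣ minimalDiscriminantInt W) (hord : ¬ (p : ℤ) ∣ W.frobeniusTrace p)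
    (κ : ZpExtension ℚ p) (hκ : κ.IsCyclotomic) (n : ℕ)
    [hV : (W.baseChange (AlgebraicClosure (v.adicCompletion ℚ))).IsIntegral w.integer]
    {d : ℕ} (hdn : p ^ n ∣ d) {π : AlgebraicClosure (v.adicCompletion ℚ)}
    (hπH : ∀ σ ∈ localSubgroup (κ.layerSubgroup n) (v.adicCompletion ℚ), σ • π = π)
    (hπ : w π ^ d = w (p : AlgebraicClosure (v.adicCompletion ℚ))) :
    Finite (W.localTowerKerPrimary κ (v.adicCompletion ℚ) n) := by
  obtain ⟨c₀, hC1⟩ := W.exists_kummerCount_layer_of_ordinary hw hpv hΔ hord κ hκ n hdn hπH hπ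
  exact W.finite_localTowerKerPrimary_of_ordinary_of_count_of_uniformizer hw hpv hΔ hord κ hκ n hC1
    hπH hπ hdn

end Layer

/-! ## §2 `p = 2`: every layer, unconditionally -/

section Two

variable (W : WeierstrassCurve ℚ) [W.IsGloballyMinimal] [W.IsElliptic] {v : HeightOneSpectrum (𝓞 ℚ)}

/-- **Greenberg's Lemma 3.4 at EVERY layer `n` of the cyclotomic `ℤ₂`-extension of `ℚ`, for `E/ℚ`
good ordinary at `2` — unconditionally.** For a globally minimal `W/ℚ` with `2 ∤ Δ_W`, `2 ∤ a_2`, the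
cyclotomic `ℤ₂`-extension `κ`, `v ∋ 2` and any `n`, the `2`-power torsion `𝒦_{v,n}[2^∞]` of
`ker (H¹(H_{v,n}, E(K̄_v)) → H¹(H_{v,∞}, E(K̄_v)))` (`W.localTowerKerPrimary κ ℚ_v n`) is finite.
The uniformiser of `(ℚ_n)_2` is `π_n = 2 - (ζ + ζ⁻¹)` for a primitive `2^{n+2}`-th root of unity
`ζ ∈ ℚ̄`: `ζ + ζ⁻¹ ∈ ℚ_n` (`ZpExtension.IsCyclotomic.add_inv_mem_layer`), so the image of `π_n` in
`K̄_v` is fixed by `H_{v,n}`, and `|π_n|^{2ⁿ} = |2|` (`spectralValuation_two_sub_add_inv_pow_eq`);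
apply `finite_localTowerKerPrimary_of_ordinary_of_uniformizer` with `d = 2ⁿ` on the spectral
valuation of the tree and the integral model `W_ℤ ⊗ 𝒪_w`. Greenberg, LNM 1716, §3 Lemma 3.4
(p. 89); Washington §13.1. [cite: GreenbergLNM1716, §3 Lemma 3.4 (p. 89)]
[cite: Washington1997, §13.1] -/
theorem finite_localTowerKerPrimary_of_ordinary_two
    (hpv : ((2 : ℕ) : 𝓞 ℚ) ∈ v.asIdeal)
    (hΔ : ¬ ((2 : ℕ) : ℤ) ∣ minimalDiscriminantInt W) (hord : ¬ ((2 : ℕ) : ℤ) ∣ W.frobeniusTrace 2)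
    (κ : ZpExtension ℚ 2) (hκ : κ.IsCyclotomic) (n : ℕ) :
    Finite (W.localTowerKerPrimary κ (v.adicCompletion ℚ) n) := by
  obtain ⟨w, hw⟩ := v.exists_spectralValuation
  haveI hV : (W.baseChange (AlgebraicClosure (v.adicCompletion ℚ))).IsIntegral w.integer :=
    ⟨⟨(integralModelInt W).map (algebraMap ℤ ↥w.integer),
      W.baseChange_eq_localIntModel_integer_baseChange⟩⟩
  -- a primitive `2^{n+2}`-th root of unity in `ℚ̄`, `θ = ζ + ζ⁻¹ ∈ ℚ_n`
  haveI : NeZero (2 ^ (n + 2) : ℕ) := ⟨pow_ne_zero _ two_ne_zero⟩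
  obtain ⟨ζ, hζ⟩ := HasEnoughRootsOfUnity.exists_primitiveRoot (AlgebraicClosure ℚ) (2 ^ (n + 2))
  have hθ : ζ + ζ⁻¹ ∈ κ.layer n := ZpExtension.IsCyclotomic.add_inv_mem_layer hκ n hζ
  have hθfix : ∀ σ' ∈ κ.layerSubgroup n,
      (absoluteGaloisGroup.toAlgEquiv ℚ σ') (ζ + ζ⁻¹) = ζ + ζ⁻¹ := by
    intro σ' hσ'
    have hmem := hθ
    change ζ + ζ⁻¹ ∈ IntermediateField.fixedField _ at hmem
    rw [IntermediateField.mem_fixedField_iff] at hmem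
    exact hmem _ ⟨σ', hσ', rfl⟩
  -- `π = ι(2 - θ) = 2 - (ιζ + (ιζ)⁻¹)`
  let ι := closureEmb (K := ℚ) (v.adicCompletion ℚ)
  let π : AlgebraicClosure (v.adicCompletion ℚ) := ι (2 - (ζ + ζ⁻¹))
  have hπH : ∀ σ ∈ localSubgroup (κ.layerSubgroup n) (v.adicCompletion ℚ), σ • π = π := by
    intro σ hσ
    rw [mem_localSubgroup_iff] at hσ
    have h := apply_resGalAuxOfEmb_apply (closureEmb (K := ℚ) (v.adicCompletion ℚ)) σ (2 - (ζ + ζ⁻¹))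
    have hfix : (absoluteGaloisGroup.toAlgEquiv ℚ (resGal (K := ℚ) (v.adicCompletion ℚ) σ))
        (2 - (ζ + ζ⁻¹)) = 2 - (ζ + ζ⁻¹) := by
      rw [map_sub, map_ofNat, hθfix _ hσ]
    change closureEmb (K := ℚ) (v.adicCompletion ℚ)
      ((absoluteGaloisGroup.toAlgEquiv ℚ (resGal (K := ℚ) (v.adicCompletion ℚ) σ))
        (2 - (ζ + ζ⁻¹))) = σ • π at h
    rw [hfix] at h
    exact h.symm
  have hζ' : IsPrimitiveRoot (ι ζ) (2 ^ (n + 2)) := hζ.map_of_injective ι.injective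
  have hπ : w π ^ 2 ^ n = w ((2 : ℕ) : AlgebraicClosure (v.adicCompletion ℚ)) := by
    have e : π = 2 - (ι ζ + (ι ζ)⁻¹) := by
      change ι (2 - (ζ + ζ⁻¹)) = _
      rw [map_sub, map_ofNat, map_add, map_inv₀]
    rw [e]
    exact spectralValuation_two_sub_add_inv_pow_eq hζ'
  exact W.finite_localTowerKerPrimary_of_ordinary_of_uniformizer hw hpv hΔ hord κ hκ n (d := 2 ^ n)
    dvd_rfl hπH hπ

end Two

end WeierstrassCurve
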